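import Mathlib
import HarnessLib
import HarnessLib.Audit
import Summits.HubbardSuperconductivity.Statement
import Literature.MathematicalPhysics.QuantumLattice.HeisenbergModel
import Summits.HubbardSuperconductivity.HubbardSuperconductivity.Theorems.AnisotropyChordSectorAnchorXY
import HarnessLib.Audit.Status.Attr

/-!
Route: PlaquetteBoson

Route PlaquetteBoson — HubbardSuperconductivity/HubbardSuperconductivity (plancards window
20260815w1).
Cards realised: HubbardSuperconductivity/HubbardSuperconductivity/monotone-depletion-interpolation
(primary; novelty audit: new-mechanism), .../plaquette-boson-kls-anchor (the dictionary),
.../uv-ir-handshake-lp-kls (engine of crux PbHalfFilledXYOrder).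

THESIS X (it suffices to show) = ANCHOR ∧ CONTINUATION:
(ANCHOR, PbAnchorOrder) there are U > 0 in the plaquette pair-binding window, a doping δ ∈ (0,1/2)
and t₀ > 0 such that for every inter-plaquette hopping t' ∈ (0,t₀) every (N_L, S^z=0)-sector ground
state of the CHECKERBOARD Hubbard torus H_L(t',U) (2×2 plaquettes with t = 1 and on-site U, glued by
hopping t'; L ∈ 4ℕ large; N_L = 2⌊(1-δ)L²/2⌋) has d_{x²-y²} pair-field order ⟨ψ, Δ_d†Δ_d ψ⟩ ≥
c(t')·L⁴; and
(CONTINUATION, PbContinuation) at that (U,δ) such small-t' order forces the summit's conclusion for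
the uniform model hubbardTorus 2 L 1 U = H_L(1,U) along all even sides.
Assembly (pure logic, rc0 in the planner's sketch): PbAnchorOrder → PbContinuation →
HubbardSuperconductivity.
One-line Lean form of X: `PbAnchorOrder ∧ PbContinuation` with the two decls of this file (both
elaborate; all constants exist: Literature.MathematicalPhysics.QuantumLattice.hamiltonian /
fermionTorusGraph / IsGroundStateInSector / pairField / dWaveFormFactor / hubbardTorus /
torusPullback / pairFieldCorr, Literature.Probability.LatticeModels.HasLongRangeOrder / halfOpenBox;
the checkerboard graphs are fermionTorusGraph 2 L minus/inter SimpleGraph.comap (plaquette label)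
⊤).

TWO-LAYER PLAN (D-0019). Layer 1 = the ranked cruxes below. Layer 2 (glue later, at the first split
of PbAnchorOrder): the BOSONIC ENGINE already filed as typed statements — PbMonotoneDepletion (rank
2, the new mechanism: 'adding a hard-core boson never raises the condensate fraction', (N+1)Λ(N) ≥
NΛ(N+1) for sector ground states of the S=½ ferro-XY/AF-Ising torus model = hard-core bosons with
n.n. repulsion), PbHalfFilledXYOrder (rank 4, reflection-positivity input at half filling, open at
the needed anisotropy Δ_eff(U) ≈ -0.99; engine: LP over the structure factor with SDP-certified
short-range rows), PbInterpolation (support, provable now: the two give a condensate ≥ 2ρ·c·M⁴ at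
EVERY boson filling ρ ∈ (0,1/2], i.e. every doping δ = ρ/2 ∈ (0,1/4]) — plus the glue to be filed
then: second-order Schrieffer–Wolff of H_L(t',U) onto plaquette-pair hard-core bosons on the
(L/2)-torus (J(U)t'², V(U)t'², Δ_eff = -V/2J) and the DRESSING LEMMA (the boson condensate survives
the O(t'³) non-reflection-positive remainder and projects onto Δ_d with O(1) overlap).
Ranked cruxes: 2 PbMonotoneDepletion (most informative, cheapest to refute, frees δ from the RP
value 1/4) · 3 PbAnchorOrder (the anchor theorem; Literature-grade alone) · 4 PbHalfFilledXYOrder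
(RP input near the Heisenberg point) · 5 PbContinuation (the bet). Support: PbInterpolation. 6
items.

Rationale: WHY THIS LINE. Ground-state order for a continuous symmetry in d = 2 has been PROVED in exactly one
way: reflection positivity ⇒ Gaussian domination ⇒ infrared bound, closed at T = 0 by the
Kennedy–Lieb–Shastry sum rule (KLS1988PRL, KLS1988JSP; S=½ XXZ window KuboKishi1988; hard-core
bosons at half filling AizenmanEtAl2004). Gaussian domination only bounds operators that couple
ACROSS the reflection plane; for Hubbard electrons those are single fermions, so the pairs must
first be made elementary: contract 2×2 plaquettes (checkerboard Hubbard model, TsaiKivelson2006,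
YaoTsaiKivelson2007), whose two-hole ground state is a B1g singlet for 0 < U < 4.58, giving
hard-core d-wave-pair bosons with J, V = O(t'²) (card plaquette-boson-kls-anchor). RP pins the boson
filling to 1/2 (doping 1/4); the NEW MECHANISM of card monotone-depletion-interpolation — one RP
point + 'adding a hard-core boson never raises the condensate fraction' — transports the order to
every filling by a three-line interpolation, freeing δ. Imported areas: reflection positivity /
infrared bounds (mathematical physics of spin systems), stoquastic positivity (Perron–Frobenius,
loop representations, log-concavity in a conserved charge), LP/SDP certificates for the
near-Heisenberg RP input (WangEtAl2024, arXiv:2410.00810; card uv-ir-handshake-lp-kls), certified ED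
for plaquette data. Catalogue entries used: physical analogy WITH explicit dictionary (boson =
plaquette B1g hole pair, ρ_b = 2δ, Δ_eff = -V/2J), certified computation, monotone/invariant
quantity.
RANKED CRUXES. 2 PbMonotoneDepletion — new bosonic inequality; refutable by ED on 4×4…6×6 tori (card
script hcb_depletion.py, unrun: compute daemon down at filing) — FIRST THING a refuter should run. 3
PbAnchorOrder — the anchor theorem (first rigorous d-wave superconductor from repulsive electrons if
it lands); contains the dressing lemma ('RP fragility', open). 4 PbHalfFilledXYOrder on (-1,0] —
known for |Δ| ≲ 0.2 only; needed at Δ_eff(U) ≈ -0.99. 5 PbContinuation t' → 1 — the bet; evidence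
DoluweeraEtAl2008 (DCA: d-wave SC along the path, suppressed by inhomogeneity, maximal at t'=1),
ChakrabortySenechalTremblay2011.
KILL CRITERIA. (i) ED finds (N+1)Λ(N) < NΛ(N+1) persisting with M at some Δ ∈ [-1,0] in the regime
the route needs (then restate to N ≥ N₀ / limiting concavity, or close if the dome itself is
non-concave); (ii) certified two-plaquette ED shows no U with pair binding AND a usable t'-window
(anchor empty) → close; (iii) numerics show a transition on the t' path for every (U,δ) window →
close route, keep PbMonotoneDepletion/PbHalfFilledXYOrder as Literature targets; (iv)
PbHalfFilledXYOrder refuted at some Δ ∈ (-1,0] → restate on the surviving interval if it still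
contains a Δ_eff(U).
NOT DECOMPOSED YET (deliberately): the Schrieffer–Wolff/dressing glue under PbAnchorOrder (needs the
certified plaquette data J(U), V(U), Δ_pb(U) first), the L ≡ 2 mod 4 comparison, any mechanism for
PbContinuation, fillings ρ > 1/2 (particle–hole map, unnecessary for one witness doping).
NOVELTY (full text in the route's Novelty field): nearest prior art KLS1988PRL/AizenmanEtAl2004
(order at half filling only; LiebSeiringerSolovejYngvason2005: other fillings open, 'dictated by the
method'), YaoTsaiKivelson2007 (the δ=1/4 ⇔ zero-field XXZ dictionary, non-rigorous),
Toth1990/Penrose1991 (complete graph: f(N) exactly decreasing); delta = monotone depletion as the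
transport device + the anchor-and-continue assembly to the summit; audited new-mechanism on the
card.
BARRIERS (full text in the Barriers field): StrongCouplingCeiling evaded (no t/U expansion; SW
around gapped plaquettes, order from RP + positivity), Weak-coupling/PerturbativeInvisibility/gHF
not in class, LROForcesLowLyingStates respected (fixed-N LRO only), T>0 barriers untouched,
SignProblemNPHard irrelevant (stoquastic effective model), PureModelStripeCompetition =
PbContinuation's risk; honest limit: RP is still the only source of continuous-symmetry GS order and
PbHalfFilledXYOrder is open where needed.

Novelty: Searched (this session + the cards' audited searches): lit search crossref 'checkerboard Hubbard
model superconductivity plaquette' (→ doi:10.1103/physrevb.76.161104 YaoTsaiKivelson2007,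
doi:10.1103/physrevb.78.020504 DoluweeraEtAl2008, doi:10.1103/physrevb.84.054545
ChakrabortySenechalTremblay2011), crossref 'condensate fraction hard-core bosons two-dimensional
lattice' (QMC only: doi:10.1103/physrevb.49.9009, BernardetEtAl2002), crossref 'monotonicity ground
state energy magnetization Lieb Mattis' (doi:10.1063/1.1724276, NachtergaeleStarr2005 — energy
ordering, not condensate), lit galaxy --star all 'hard-core bosons off-diagonal long-range order' (0
rows), lit frontier/bridges HubbardSuperconductivity (arXiv:2410.00810 symmetry bootstrap = SDP
engine for crux 4); local searchd was unavailable (rc 75). Nearest prior art: KLS1988PRL +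
AizenmanEtAl2004 (BEC/XY LRO of hard-core lattice bosons proved ONLY at half filling;
LiebSeiringerSolovejYngvason2005 ch. 11: other fillings open, restriction 'dictated by the method');
KuboKishi1988 (S=½ XXZ window |Δ| ≲ 0.2); YaoTsaiKivelson2007 / TsaiKivelson2006 (checkerboard
Hubbard → effective hard-core boson XXZ model at x = 1/4, superfluid for U < U_s ≈ 2.7,
non-rigorous); Toth1990 / Penrose1991 (complete-graph hard-core gas, condensate per particle exactly
decreasing in N). DELTA: (1) the load-bearing inequality (N+1)Λ(N) ≥ NΛ(N+1) for sector ground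
states of the n.n. torus gas and its use to TRANSPORT reflection-positivity order off  [refs: 10.1103/physrevb.76.161104, 10.1103/physrevb.78.020504, 10.1103/physrevb.84.054545, 10.1103/physrevb.49.9009, 10.1063/1.1724276, 2410.00810, doi:10.1103/physrevb.76.161104, doi:10.1103/physrevb.78.020504, doi:10.1103/physrevb.84.054545, doi:10.1103/physrevb.49.9009, doi:10.1063/1.1724276, YaoTsaiKivelson2007, DoluweeraEtAl2008, ChakrabortySenechalTremblay2011, BernardetEtAl2002, NachtergaeleStarr2]

Barriers (technique_class: reflection-positivity; effective-boson; charge-monotonicity): - Literature.Barriers.HubbardSuperconductivity.StrongCouplingCeiling: evaded — no t/U,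
high-temperature, cluster or Pirogov–Sinai expansion of the SU(2) model is used; the only expansion
is second-order Schrieffer–Wolff in t'/Δ_pb around DECOUPLED 4-site plaquettes with a unique gapped
paired ground state in the relevant sectors, and it only has to deliver an operator identity H(t') =
H_eff + R; the gapless superfluid order comes from RP/IR bounds + monotone depletion on the
stoquastic effective model. Residue: the dressing step inside PbAnchorOrder (admitted, it is that
crux's why-might-fail).
- Literature.Barriers.HubbardSuperconductivity.WeakCouplingCeiling: not in class — no expansion in
U, no Cooper logarithm; U = O(1) in the plaquette pair-binding window, pairs are preformed and
Bose-condense.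
- Literature.Barriers.HubbardSuperconductivity.PerturbativeInvisibilityOfPairing: not in class —
nothing is read off a power series in U.
- Literature.Barriers.HubbardSuperconductivity.GeneralizedHartreeFockNoPairing: not in class — no
quasi-free/mean-field state; the anchor ground state is a Perron–Frobenius boson condensate dressed
by Schrieffer–Wolff.
- Literature.Barriers.HubbardSuperconductivity.LROForcesLowLyingStates: respected — every order
statement is ⟨Δ†Δ⟩-type LRO of fixed-N sector ground states (no anomalous averages, no gap or
uniqueness hypothesis); PbMonotoneDepletion compares adjacent N-sectors, the tower of states lives
across N and is harmless.
- Literature.Barr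

Novelty grade: new-combination — ROUTE REVIEW gen-1 (refuter f31d8029; after 853747fc, g14-0/g13-35, 2c4772d4): KEEP; MAIN OBJECTION = DUPLICATION; one strength caveat. Lean: 8 typed decls rc0; Assembly proved (evidence 0909); 0906 at Δ=0 instantiates to 0977 (checked). Defs re-read: ferro-XY/AF-Ising = hard-core bosons hop −1/2, V (refuter refuter-rreview-route-NavierStokesRegula-f31d8029-0, 2026-08-15T14:11:56Z; prior: KLS1988PRL / AizenmanEtAl2004 (RP at half filling), LiebSeiringerSolovejYngvason2005 ch.11, KuboKishi1988, Toth1990 / Penrose1991 (complete graph), doi:10.1103/physrevb.76.161104 YaoTsaiKivelson2007, doi:10.1103/physrevb.73.214510 TsaiKivelson2006, doi:10.1063/1.1705219 Griffiths 1967 (transport architecture), route-HubbardSuperconductivity-PairBosonDome (near-duplicate))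

History (route lifecycle, newest last):
- 2026-08-17T11:41:48Z · rev 5: dropped PbXYSectorAnchor — cone repair (rrepair-954a431b): drop support item PbXYSectorAnchor (stmt-0977, CLOSED/proved 2026-08-17T11:20Z by Theorems.AnisotropyChord.sectorAnchorXY_proof; (planner-rrepair-HubbardSuperconductivity-Plaqu-954a431b-0)
- 2026-08-24T08:08:03Z · DORMANT — reconciler: no traction for 6.6 d (last activity item-evidence-added at 2026-08-17T16:53:30Z); parked, not closed — `ledger route dormant route-HubbardSupercond (operator:999:3322589)
- 2026-08-26T04:25:47Z · REACTIVATED — reconciler: reactivated — activity item-evidence-added at 2026-08-25T19:28:31Z after parking at 2026-08-24T08:08:03Z (operator:999:2683979)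

sub-problem: HubbardSuperconductivity · status: open · opened planner-plancards-HubbardSuperconductivity-HubbardSuperconducti-91ae773cb2-0 2026-08-15T10:34:39Z · rev 6 · ledger route-HubbardSuperconductivity-PlaquetteBoson
GENERATED by the gate from the ledger (D-0016/17). Provers cite these decls: `theorem foo : Summit.HubbardSuperconductivity.HubbardSuperconductivity.Theses.PlaquetteBoson.<Decl> := …` in Summits/HubbardSuperconductivity/HubbardSuperconductivity/Theorems/<Name>.lean.
-/

namespace Summit.HubbardSuperconductivity.HubbardSuperconductivity.Theses.PlaquetteBoson

open scoped BigOperators Topology Manifold Classical MeasureTheory ProbabilityTheory Matrix InnerProductSpace ComplexConjugate ContinuousMap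
open Filter Set Function TopologicalSpace MeasureTheory

attribute [summit_statement] _root_.HubbardSuperconductivity

open Literature.Hubbard

/-! Retired items kept as plain definitions (history; not obligations of this route): landed proofs / closed glue still name them. -/

/-- retired stmt-HubbardSuperconductivity-0977 (dropped, gen None) — proved by Summit.HubbardSuperconductivity.HubbardSuperconductivity.Theorems.AnisotropyChord.sectorAnchorXY_proof @ c0c71b94710e. -/
def PbXYSectorAnchor : Prop :=
  ∃ c : ℝ, 0 < c ∧ ∃ M₀ : ℕ, ∀ (M : ℕ) [NeZero M], Even M → M₀ ≤ M → ∀ (ψ : Literature.MathematicalPhysics.QuantumLattice.TensorIndex (Literature.Probability.LatticeModels.TorusSite 2 M) 2 → ℂ), ψ ∈ Literature.MathematicalPhysics.QuantumLattice.spinZSector (Λ := Literature.Probability.LatticeModels.TorusSite 2 M) 1 0 → star ψ ⬝ᵥ ψ = 1 → Matrix.mulVec (Literature.MathematicalPhysics.QuantumLattice.xxzHamiltonian 1 (Literature.Probability.LatticeModels.torusGraph 2 M) (-1) 0) ψ = ((Literature.MathematicalPhysics.QuantumLattice.lowestEnergyInSector 1 (Literature.MathematicalPhysics.QuantumLattice.xxzHamiltonian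 1 (Literature.Probability.LatticeModels.torusGraph 2 M) (-1) 0) 0 : ℝ) : ℂ) • ψ → c * (M : ℝ) ^ 4 ≤ (star ψ ⬝ᵥ Matrix.mulVec ((∑ x : Literature.Probability.LatticeModels.TorusSite 2 M, Literature.MathematicalPhysics.QuantumLattice.onSite x (Literature.MathematicalPhysics.QuantumLattice.spinRaise 1)) * (∑ y : Literature.Probability.LatticeModels.TorusSite 2 M, Literature.MathematicalPhysics.QuantumLattice.onSite y (Literature.MathematicalPhysics.QuantumLattice.spinLower 1))) ψ).re

/-- item stmt-HubbardSuperconductivity-0904 · crux · rank 2 · open · by planner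
why it might fail: No tool: with KLS at Δ=0 it gives BEC of 2D hard-core lattice bosons at EVERY filling, open since 1988 (RP needs half filling, LSSY2005 ch.11). No monotonicity-in-N theorem for an interacting lattice gas beyond the complete graph (Toth1990); QMC domes only. ∃M₀ ⇒ ED can't refute; risk: mid fillings.
sources: book:lieb2005-mathematics-bose-gas-its-condensation p0117, LiebSeiringerSolovejYngvason2005, AizenmanEtAl2004, KLS1988PRL, Toth1990, Penrose1991
[crux] MONOTONE DEPLETION (card monotone-depletion-interpolation, its input (B); the route's new
mechanism). Dictionary: hard-core bosons with n.n. hopping 1/2 and repulsion V on the even torus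
(ℤ/Mℤ)² = S=½ `xxzHamiltonian 1 (torusGraph 2 M) (-1) Δ` (ferro XY, Ising anisotropy Δ = −V ∈
[−1,0], Δ = −1 the Heisenberg/checkerboard point); boson = up spin, N bosons = sector S^z_tot = N −
M²/2 (`spinZSector 1`), condensate Λ(ψ) = ⟨ψ, S⁺_tot S⁻_tot ψ⟩ = ‖Bψ‖² = M²·(number of k=0 bosons).
CLAIM: for every Δ ∈ [−1,0], eventually in even M, for all 1 ≤ N < M²/2 and normalised sector ground
states ψ_N, ψ_{N+1}: (N+1)·Λ(ψ_N) ≥ N·Λ(ψ_{N+1}) — 'adding a hard-core boson never raises the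
condensate fraction'. H is stoquastic in the S^z basis, so each sector GS is unique and positive
(Perron–Frobenius) and 'every GS' costs nothing. Evidence: equality for the ideal lattice gas, exact
and strict on the complete graph (Tóth 1990 / Penrose 1991: f(N) = (M−N+1)/M), 1D asymptotics
(Lenard), every QMC condensate dome (Bernardet et al. 2002). Candidate engines: worm/loop
representation with positive weights (adding a particle adds an avoiding world-line), first-moment
identities ⟨B†[H,B]⟩ + variational E -/
@[route_item "route-HubbardSuperconductivity-PlaquetteBoson"]
def PbMonotoneDepletion : Prop :=
  ∀ Δ ∈ Set.Icc (-1:ℝ) 0, ∃ M₀ : ℕ, ∀ (M : ℕ) [NeZero M], Even M → M₀ ≤ M → ∀ N : ℕ, 1 ≤ N → 2 * (N + 1) ≤ M ^ 2 → ∀ (ψ φ : Literature.MathematicalPhysics.QuantumLattice.TensorIndex (Literature.Probability.LatticeModels.TorusSite 2 M) 2 → ℂ), ψ ∈ Literature.MathematicalPhysics.QuantumLattice.spinZSector (Λ := Literature.Probability.LatticeModels.TorusSite 2 M) 1 ((N : ℝ) - (M : ℝ) ^ 2 / 2) → star ψ ⬝ᵥ ψ = 1 → Matrix.mulVec (Literature.MathematicalPhysics.QuantumLattice.xxzHamiltonian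 1 (Literature.Probability.LatticeModels.torusGraph 2 M) (-1) Δ) ψ = ((Literature.MathematicalPhysics.QuantumLattice.lowestEnergyInSector 1 (Literature.MathematicalPhysics.QuantumLattice.xxzHamiltonian 1 (Literature.Probability.LatticeModels.torusGraph 2 M) (-1) Δ) ((N : ℝ) - (M : ℝ) ^ 2 / 2) : ℝ) : ℂ) • ψ → φ ∈ Literature.MathematicalPhysics.QuantumLattice.spinZSector (Λ := Literature.Probability.LatticeModels.TorusSite 2 M) 1 ((N : ℝ) + 1 - (M : ℝ) ^ 2 / 2) → star φ ⬝ᵥ φ = 1 → Matrix.mulVec (Literature.MathematicalPhysics.QuantumLattice.xxzHamiltonian 1 (Literature.Probability.LatticeModels.torusGraph 2 M) (-1) Δ) φ = ((Literature.MathematicalPhysics.QuantumLattice.lowestEnergyInSector 1 (Literature.MathematicalPhysics.QuantumLattice.xxzHamiltonian 1 (Literature.Probability.LatticeModels.torusGraph 2 M) (-1) Δ) ((N : ℝ) + 1 - (M : ℝ) ^ 2 / 2) : ℝ) : ℂ) • φ → (N : ℝ) * (star φ ⬝ᵥ Matrix.mulVec ((∑ x : Literature.Probability.LatticeModels.TorusSite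 2 M, Literature.MathematicalPhysics.QuantumLattice.onSite x (Literature.MathematicalPhysics.QuantumLattice.spinRaise 1)) * (∑ y : Literature.Probability.LatticeModels.TorusSite 2 M, Literature.MathematicalPhysics.QuantumLattice.onSite y (Literature.MathematicalPhysics.QuantumLattice.spinLower 1))) φ).re ≤ ((N : ℝ) + 1) * (star ψ ⬝ᵥ Matrix.mulVec ((∑ x : Literature.Probability.LatticeModels.TorusSite 2 M, Literature.MathematicalPhysics.QuantumLattice.onSite x (Literature.MathematicalPhysics.QuantumLattice.spinRaise 1)) * (∑ y : Literature.Probability.LatticeModels.TorusSite 2 M, Literature.MathematicalPhysics.QuantumLattice.onSite y (Literature.MathematicalPhysics.QuantumLattice.spinLower 1))) ψ).re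

/-- item stmt-HubbardSuperconductivity-0905 · crux · rank 3 · open · by planner
why it might fail: U<U_s≈2.7 forces V/t→2⁻ (YTK p.4): RP input at Δ_eff≈-0.99, proved only for |Δ|<0.22 (WMH1991); t₀(U)≲Δ_pb(U)→0 as U→0; gapless U(1) order of H_eff must survive the extensive non-RP O(t'³) SW remainder, no stability theorem (arXiv:2603.13212: finite groups only); 1st-order PS near U_s.
sources: YaoTsaiKivelson2007, arXiv:0706.0761, TsaiKivelson2006, doi:10.1051/jp1:1991109, KuboKishi1988, KLS1988PRL
[crux] ANCHOR THEOREM (cards plaquette-boson-kls-anchor A1–A3 with δ freed by monotone depletion).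
H_L(t',U) := `hamiltonian G_intra 1 U + hamiltonian G_inter t' 0` on Fock((ℤ/Lℤ)²), G_intra = n.n.
bonds inside the 2×2 blocks {2a,2a+1}×{2b,2b+1} (fermionTorusGraph 2 L minus SimpleGraph.comap
(plaquette label x ↦ (⌊x₀/2⌋,⌊x₁/2⌋)) ⊤), G_inter = the remaining n.n. bonds (hopping t', no second
U); H_L(1,U) = hubbardTorus 2 L 1 U. CLAIM: ∃ U>0, δ∈(0,1/2), t₀>0 ∀ t'∈(0,t₀) ∃ c>0: for all large
L ∈ 4ℕ every normalised (N_L,S^z=0)-sector GS of H_L(t',U), N_L = 2⌊(1−δ)L²/2⌋, has Re⟨ψ, Δ_d†Δ_d ψ⟩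
≥ cL⁴ (Δ_d = pairField dWaveFormFactor L, the summit's own operator; L ∈ 4ℕ because RP on the
(L/2)-plaquette torus needs even side). INTENDED SECOND LAYER (glue, filed at the first split): (i)
certified ED of one/two plaquettes: pair binding Δ_pb(U) > 0, B1g selection rule, J(U), V(U),
Δ_eff(U) = −V/2J for U in an explicit interval below U_s ≈ 2.7; (ii) second-order Schrieffer–Wolff
H_L(t',U) ≅ H_XXZ(J t'², Δ_eff) ⊕ high sector + R, ‖R‖ = O(t'³/Δ_pb²) per site; (iii)
PbHalfFilledXYOrder(Δ_eff) + PbMonotoneDepletion ⇒ (PbInterpolation) boson condensate ≥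
2·(2δ)·c·(L/2)⁴ at boson filling 2δ ≤ 1/2; (i -/
@[route_item "route-HubbardSuperconductivity-PlaquetteBoson", crux]
def PbAnchorOrder : Prop :=
  ∃ U : ℝ, 0 < U ∧ ∃ δ ∈ Set.Ioo (0:ℝ) (1/2), ∃ t₀ : ℝ, 0 < t₀ ∧ ∀ t' ∈ Set.Ioo (0:ℝ) t₀, ∃ c : ℝ, 0 < c ∧ ∃ L₀ : ℕ, ∀ (L : ℕ) [NeZero L], L₀ ≤ L → 4 ∣ L → ∀ (N : ℕ) (ψ : Literature.MathematicalPhysics.QuantumLattice.Fock (Literature.MathematicalPhysics.QuantumLattice.Orb (Literature.MathematicalPhysics.QuantumLattice.FermionTorus 2 L))), N = 2 * ⌊(1 - δ) * (L : ℝ) ^ 2 / 2⌋₊ → star ψ ⬝ᵥ ψ = 1 → Literature.MathematicalPhysics.QuantumLattice.IsGroundStateInSector (Literature.MathematicalPhysics.QuantumLattice.hamiltonian ((Literature.MathematicalPhysics.QuantumLattice.fermionTorusGraph 2 L) \ SimpleGraph.comap (fun x : Literature.MathematicalPhysics.QuantumLattice.FermionTorus 2 L => fun i : Fin 2 => ((ofLex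 x) i : ℕ) / 2) ⊤) 1 U + Literature.MathematicalPhysics.QuantumLattice.hamiltonian ((Literature.MathematicalPhysics.QuantumLattice.fermionTorusGraph 2 L) ⊓ SimpleGraph.comap (fun x : Literature.MathematicalPhysics.QuantumLattice.FermionTorus 2 L => fun i : Fin 2 => ((ofLex x) i : ℕ) / 2) ⊤) t' 0) N 0 ψ → c * (L : ℝ) ^ 4 ≤ (Literature.MathematicalPhysics.QuantumLattice.expect ((Literature.MathematicalPhysics.QuantumLattice.pairField Literature.MathematicalPhysics.QuantumLattice.dWaveFormFactor L)ᴴ * Literature.MathematicalPhysics.QuantumLattice.pairField Literature.MathematicalPhysics.QuantumLattice.dWaveFormFactor L) ψ).re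

/-- item stmt-HubbardSuperconductivity-0906 · crux · rank 4 · open · by planner
why it might fail: Claims ALL Δ∈(-1,0]; RP+IR bound+KLS sum rule prove xy-LRO for S=½, d=2 only for |Δ|<0.13 (KuboKishi1988), |Δ|<0.22 (WMH1991: 'further significant improvements seem quite unlikely'); KLS1988PRL: fails at the isotropic point, ν=2. Needed Δ_eff≈-0.99 abuts the open 2D S=½ Heisenberg GS order.
sources: KLS1988PRL, book:liebnd-statistical-mechanics p0295, KuboKishi1988, doi:10.1051/jp1:1991109, doi:10.1143/jpsj.58.1027, KLS1988JSP
[crux] HALF-FILLED XY ORDER of the S=½ ferro-XY/AF-Ising torus model on the whole easy-plane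
interval Δ ∈ (−1,0] (input (A) of monotone depletion; engine = card uv-ir-handshake-lp-kls): every
normalised S^z_tot = 0 ground state ψ of `xxzHamiltonian 1 (torusGraph 2 M) (-1) Δ` on large even
tori has ⟨ψ, S⁺_tot S⁻_tot ψ⟩ ≥ c(Δ)·M⁴. KNOWN: |Δ| ≲ 0.2 by reflection positivity + Gaussian
domination + the KLS T=0 sum-rule closure (Kennedy–Lieb–Shastry 1988, Kubo–Kishi 1988; tree:
kls_xy_infraredBound_ground_holds, kennedy_lieb_shastry_xy_ground at Δ = 0 for the tracial
ground-state functional — the S^z=0-sector form here needs the sector identification, routine by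
Perron–Frobenius). NEEDED by the route: Δ = Δ_eff(U) ≈ −0.99 (0.7–1.4 % on the easy-plane side of
the Heisenberg point, where xy order is physically healthy, m ≈ 0.3, but the IR-bound closure has
O(1) slack). PROPOSED ENGINE: the linear programme over the structure factor g(k) ≥ 0 with rows {KLS
infrared bound g(k) ≤ B_e(k), sum rule, SDP-certified two-sided intervals for the short-range
correlators C(r), |r| ≤ R (Wang et al. PRX 2024; symmetry bootstrap arXiv:2410.00810)}, monotone in
R with KLS as the R = 0 vertex, dual = an ex -/
@[route_item "route-HubbardSuperconductivity-PlaquetteBoson"]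
def PbHalfFilledXYOrder : Prop :=
  ∀ Δ ∈ Set.Ioc (-1:ℝ) 0, ∃ c : ℝ, 0 < c ∧ ∃ M₀ : ℕ, ∀ (M : ℕ) [NeZero M], Even M → M₀ ≤ M → ∀ (ψ : Literature.MathematicalPhysics.QuantumLattice.TensorIndex (Literature.Probability.LatticeModels.TorusSite 2 M) 2 → ℂ), ψ ∈ Literature.MathematicalPhysics.QuantumLattice.spinZSector (Λ := Literature.Probability.LatticeModels.TorusSite 2 M) 1 0 → star ψ ⬝ᵥ ψ = 1 → Matrix.mulVec (Literature.MathematicalPhysics.QuantumLattice.xxzHamiltonian 1 (Literature.Probability.LatticeModels.torusGraph 2 M) (-1) Δ) ψ = ((Literature.MathematicalPhysics.QuantumLattice.lowestEnergyInSector 1 (Literature.MathematicalPhysics.QuantumLattice.xxzHamiltonian 1 (Literature.Probability.LatticeModels.torusGraph 2 M) (-1) Δ) 0 : ℝ) : ℂ) • ψ → c * (M : ℝ) ^ 4 ≤ (star ψ ⬝ᵥ Matrix.mulVec ((∑ x : Literature.Probability.LatticeModels.TorusSite 2 M, Literature.MathematicalPhysics.QuantumLattice.onSite x (Literature.MathematicalPhysics.QuantumLattice.spinRaise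 1)) * (∑ y : Literature.Probability.LatticeModels.TorusSite 2 M, Literature.MathematicalPhysics.QuantumLattice.onSite y (Literature.MathematicalPhysics.QuantumLattice.spinLower 1))) ψ).re

/-- item stmt-HubbardSuperconductivity-0907 · crux · rank 5 · open · by planner
why it might fail: ∀(U,δ) implication, no tool; physically FALSE where small-t' pair order exists but the uniform GS is not d_{x²-y²}: U≤4, n<0.6 (δ>0.4) is d_xy/p (DengEtAl2015 Fig.1); δ→0⁺ AF; U≈4–8 stripes (QinEtAl2020); 1st-order d-CDW/PS on the t' path near U_s (YTK p.4). Likely unprovable without a (U,δ) window.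
sources: DengEtAl2015, arXiv:1408.2088, YaoTsaiKivelson2007, DoluweeraEtAl2008, ChakrabortySenechalTremblay2011, QinEtAl2020
[crux] CONTINUATION t' → 1 (the bet A4 of plaquette-boson-kls-anchor, typed as an implication so
that the Assembly is pure logic): for all U > 0, δ ∈ (0,1/2): [anchor-type every-GS d-wave order
⟨Δ_d†Δ_d⟩ ≥ c(t')L⁴ on L ∈ 4ℕ tori for all t' ∈ (0,t₀)] ⇒ [the summit's conclusion at (U,δ): every
HYP-admissible ground-state sequence of hubbardTorus 2 L 1 U (= H_L(1,U)) has HasLongRangeOrder of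
torusPullback (pairFieldCorr dWaveFormFactor ψ) along even sides]. Content: no quantum phase
transition in t' at fixed (U,δ), plus removal of the L ≡ 0 mod 4 artefact at the uniform point
(where no plaquette structure remains) and the pointwise-to-liminf bookkeeping (expect(Δ_d†Δ_d) =
Σ_{x,y} pairFieldCorr, `expect_pairField_conjTranspose_mul`). Tool-less today like every
continuation; handles: δ is free (pick it away from 1/8-type commensurabilities and inside the DCA
dome), Rellich/Kato continuation of the B1g pair susceptibility protected by a twist-gap lower bound
(card twist-gap-protects-condensate), and numerics FIRST (t'-scan of the d-wave order by
DCA/CDMFT/DMRG at the chosen (U,δ)). A refutation here closes the route but leaves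
PbAnchorOrder/PbMonotoneDepletion/PbHalfFilledXYOrder as Lite -/
@[route_item "route-HubbardSuperconductivity-PlaquetteBoson", crux]
def PbContinuation : Prop :=
  ∀ (U δ : ℝ), 0 < U → δ ∈ Set.Ioo (0:ℝ) (1/2) → (∃ t₀ : ℝ, 0 < t₀ ∧ ∀ t' ∈ Set.Ioo (0:ℝ) t₀, ∃ c : ℝ, 0 < c ∧ ∃ L₀ : ℕ, ∀ (L : ℕ) [NeZero L], L₀ ≤ L → 4 ∣ L → ∀ (N : ℕ) (ψ : Literature.MathematicalPhysics.QuantumLattice.Fock (Literature.MathematicalPhysics.QuantumLattice.Orb (Literature.MathematicalPhysics.QuantumLattice.FermionTorus 2 L))), N = 2 * ⌊(1 - δ) * (L : ℝ) ^ 2 / 2⌋₊ → star ψ ⬝ᵥ ψ = 1 → Literature.MathematicalPhysics.QuantumLattice.IsGroundStateInSector (Literature.MathematicalPhysics.QuantumLattice.hamiltonian ((Literature.MathematicalPhysics.QuantumLattice.fermionTorusGraph 2 L) \ SimpleGraph.comap (fun x : Literature.MathematicalPhysics.QuantumLattice.FermionTorus 2 L => fun i : Fin 2 => ((ofLex x)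 i : ℕ) / 2) ⊤) 1 U + Literature.MathematicalPhysics.QuantumLattice.hamiltonian ((Literature.MathematicalPhysics.QuantumLattice.fermionTorusGraph 2 L) ⊓ SimpleGraph.comap (fun x : Literature.MathematicalPhysics.QuantumLattice.FermionTorus 2 L => fun i : Fin 2 => ((ofLex x) i : ℕ) / 2) ⊤) t' 0) N 0 ψ → c * (L : ℝ) ^ 4 ≤ (Literature.MathematicalPhysics.QuantumLattice.expect ((Literature.MathematicalPhysics.QuantumLattice.pairField Literature.MathematicalPhysics.QuantumLattice.dWaveFormFactor L)ᴴ * Literature.MathematicalPhysics.QuantumLattice.pairField Literature.MathematicalPhysics.QuantumLattice.dWaveFormFactor L) ψ).re) → ∀ (N : ℕ → ℕ) (ψ : ∀ L, Literature.MathematicalPhysics.QuantumLattice.Fock (Literature.MathematicalPhysics.QuantumLattice.Orb (Literature.MathematicalPhysics.QuantumLattice.FermionTorus 2 L))), (∀ L, Even L → N L = 2 * ⌊(1 - δ) * (L : ℝ) ^ 2 / 2⌋₊ ∧ star (ψ L) ⬝ᵥ ψ L = 1 ∧ Literature.MathematicalPhysics.QuantumLattice.IsGroundStateInSector (Literature.MathematicalPhysics.QuantumLattice.hubbardTorus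 2 L 1 U) (N L) 0 (ψ L)) → Literature.Probability.LatticeModels.HasLongRangeOrder (fun k => Literature.Probability.LatticeModels.halfOpenBox 2 (2 * k)) (fun k => Literature.MathematicalPhysics.QuantumLattice.torusPullback (Literature.MathematicalPhysics.QuantumLattice.pairFieldCorr Literature.MathematicalPhysics.QuantumLattice.dWaveFormFactor ψ) (2 * k))

/-- item stmt-HubbardSuperconductivity-10205 · support · rank 6 · open · by planner
[crux · canary · folded in from the twin route PairBosonDome (closed as superseded by this route),
its item stmt-HubbardSuperconductivity-0917 MonotoneDepletionXY] MONOTONE DEPLETION, LITERAL Δ = 0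
FORM = this route's item 0904 PbMonotoneDepletion at Δ = 0 (pure hard-core bosons = S=½ ferro-XY
torus; xxzHamiltonian 1 (torusGraph 2 M) (-1) 0 = xyTorus 2 M 1 by rfl) with the threshold made
explicit, M₀ := 4: for EVERY even M ≥ 4, all 1 ≤ N with N+1 ≤ M²/2, and normalised sector ground
states ψ (N bosons, S^z = N − M²/2) and φ (N+1 bosons): N·⟨φ, S⁺_tot S⁻_tot φ⟩ ≤ (N+1)·⟨ψ, S⁺_tot
S⁻_tot ψ⟩ — 'adding a hard-core boson never raises the condensate per particle'. It implies 0904's Δ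
= 0 instance (take M₀ = 4; planner Sketch rc0) and is the route's only ED-DECIDABLE statement of the
mechanism (0904 hides behind ∃M₀): one negative D(N) = (N+1)Λ(N) − NΛ(N+1) on one even torus refutes
it. Sector GS unique (stoquastic + connected sector ⇒ Perron–Frobenius), so ∀ψ∀φ is harmless; same
functional as 0917 since ⟨ψ,S⁺S⁻ψ⟩ = ‖S⁻_tot ψ‖². Evidence so far (files attached to
stmt-HubbardSuperconductivity-0917: EVIDENCE-0917-ed.md, main.py, README.md; and this route's gen-1
review): D(N) > 0 for M=4 a -/
@[route_item "route-HubbardSuperconductivity-PlaquetteBoson"]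
def PbMonotoneDepletionXY : Prop :=
  ∀ (M : ℕ) [NeZero M], Even M → 4 ≤ M → ∀ N : ℕ, 1 ≤ N → 2 * (N + 1) ≤ M ^ 2 → ∀ (ψ φ : Literature.MathematicalPhysics.QuantumLattice.TensorIndex (Literature.Probability.LatticeModels.TorusSite 2 M) 2 → ℂ), ψ ∈ Literature.MathematicalPhysics.QuantumLattice.spinZSector (Λ := Literature.Probability.LatticeModels.TorusSite 2 M) 1 ((N : ℝ) - (M : ℝ) ^ 2 / 2) → star ψ ⬝ᵥ ψ = 1 → Matrix.mulVec (Literature.MathematicalPhysics.QuantumLattice.xxzHamiltonian 1 (Literature.Probability.LatticeModels.torusGraph 2 M) (-1) 0) ψ = ((Literature.MathematicalPhysics.QuantumLattice.lowestEnergyInSector 1 (Literature.MathematicalPhysics.QuantumLattice.xxzHamiltonian 1 (Literature.Probability.LatticeModels.torusGraph 2 M) (-1) 0) ((N : ℝ) - (M : ℝ) ^ 2 / 2) : ℝ) : ℂ) • ψ → φ ∈ Literature.MathematicalPhysics.QuantumLattice.spinZSector (Λ := Literature.Probability.LatticeModels.TorusSite 2 M) 1 ((N : ℝ) + 1 - (M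 : ℝ) ^ 2 / 2) → star φ ⬝ᵥ φ = 1 → Matrix.mulVec (Literature.MathematicalPhysics.QuantumLattice.xxzHamiltonian 1 (Literature.Probability.LatticeModels.torusGraph 2 M) (-1) 0) φ = ((Literature.MathematicalPhysics.QuantumLattice.lowestEnergyInSector 1 (Literature.MathematicalPhysics.QuantumLattice.xxzHamiltonian 1 (Literature.Probability.LatticeModels.torusGraph 2 M) (-1) 0) ((N : ℝ) + 1 - (M : ℝ) ^ 2 / 2) : ℝ) : ℂ) • φ → (N : ℝ) * (star φ ⬝ᵥ Matrix.mulVec ((∑ x : Literature.Probability.LatticeModels.TorusSite 2 M, Literature.MathematicalPhysics.QuantumLattice.onSite x (Literature.MathematicalPhysics.QuantumLattice.spinRaise 1)) * (∑ y : Literature.Probability.LatticeModels.TorusSite 2 M, Literature.MathematicalPhysics.QuantumLattice.onSite y (Literature.MathematicalPhysics.QuantumLattice.spinLower 1))) φ).re ≤ ((N : ℝ) + 1) * (star ψ ⬝ᵥ Matrix.mulVec ((∑ x : Literature.Probability.LatticeModels.TorusSite 2 M, Literature.MathematicalPhysics.QuantumLattice.onSite x (Literature.MathematicalPhysics.QuantumLattice.spinRaise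 1)) * (∑ y : Literature.Probability.LatticeModels.TorusSite 2 M, Literature.MathematicalPhysics.QuantumLattice.onSite y (Literature.MathematicalPhysics.QuantumLattice.spinLower 1))) ψ).re

/-- item stmt-HubbardSuperconductivity-0908 · support · rank 9 · closed · proved by Summit.HubbardSuperconductivity.HubbardSuperconductivity.Theorems.PlaquetteBoson.pbInterpolation_proof @ 9265ce3fff9b (prover) · by planner
sources: idea:HubbardSuperconductivity/HubbardSuperconductivity/monotone-depletion-interpolation, KLS1988PRL
[support] INTERPOLATION (A)+(B) ⇒ order at every boson filling ρ ∈ (0,1/2] (provable now; ~200 lines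
plus existence of a normalised ground state in each intermediate S^z-sector of a Hermitian matrix):
PbMonotoneDepletion → PbHalfFilledXYOrder → ∀ Δ ∈ (−1,0] ∀ ρ ∈ (0,1/2] ∃ c>0: eventually in even M,
every normalised sector GS with ρM² ≤ N ≤ M²/2 bosons has ⟨S⁺_tot S⁻_tot⟩ ≥ cM⁴. Proof: chain
(N+1)Λ(N) ≥ NΛ(N+1) from N up to M²/2 to get Λ(N) ≥ (2N/M²)·Λ(M²/2) ≥ 2ρ·c_HF·M⁴ (take M₀ = max of
the two thresholds). Fillings ρ ∈ [1/2,1) would follow from the particle–hole map b ↔ b† (BB† = B†B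
+ M² − 2N) but are NOT needed: the summit uses one doping δ₁ ≤ 1/4 (ρ_b = 2δ₁). This is the glue
that turns cruxes 2+4 into the bosonic input of PbAnchorOrder at any doping. -/
@[route_item "route-HubbardSuperconductivity-PlaquetteBoson"]
def PbInterpolation : Prop :=
  PbMonotoneDepletion → PbHalfFilledXYOrder → ∀ Δ ∈ Set.Ioc (-1:ℝ) 0, ∀ ρ ∈ Set.Ioc (0:ℝ) (1/2), ∃ c : ℝ, 0 < c ∧ ∃ M₀ : ℕ, ∀ (M : ℕ) [NeZero M], Even M → M₀ ≤ M → ∀ N : ℕ, ρ * (M : ℝ) ^ 2 ≤ (N : ℝ) → 2 * N ≤ M ^ 2 → ∀ (ψ : Literature.MathematicalPhysics.QuantumLattice.TensorIndex (Literature.Probability.LatticeModels.TorusSite 2 M) 2 → ℂ), ψ ∈ Literature.MathematicalPhysics.QuantumLattice.spinZSector (Λ := Literature.Probability.LatticeModels.TorusSite 2 M) 1 ((N : ℝ) - (M : ℝ) ^ 2 / 2) → star ψ ⬝ᵥ ψ = 1 → Matrix.mulVec (Literature.MathematicalPhysics.QuantumLattice.xxzHamiltonian 1 (Literature.Probability.LatticeModels.torusGraph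 2 M) (-1) Δ) ψ = ((Literature.MathematicalPhysics.QuantumLattice.lowestEnergyInSector 1 (Literature.MathematicalPhysics.QuantumLattice.xxzHamiltonian 1 (Literature.Probability.LatticeModels.torusGraph 2 M) (-1) Δ) ((N : ℝ) - (M : ℝ) ^ 2 / 2) : ℝ) : ℂ) • ψ → c * (M : ℝ) ^ 4 ≤ (star ψ ⬝ᵥ Matrix.mulVec ((∑ x : Literature.Probability.LatticeModels.TorusSite 2 M, Literature.MathematicalPhysics.QuantumLattice.onSite x (Literature.MathematicalPhysics.QuantumLattice.spinRaise 1)) * (∑ y : Literature.Probability.LatticeModels.TorusSite 2 M, Literature.MathematicalPhysics.QuantumLattice.onSite y (Literature.MathematicalPhysics.QuantumLattice.spinLower 1))) ψ).re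

-- `PbInterpolation` holds: proved by `Summit.HubbardSuperconductivity.HubbardSuperconductivity.Theorems.PlaquetteBoson.pbInterpolation_proof` @ 9265ce3fff9b (its module imports this route file, so no `_holds` link can be stated here).

/-- item stmt-HubbardSuperconductivity-1029 · support · rank 9 · closed · proved by Summit.HubbardSuperconductivity.HubbardSuperconductivity.Theorems.PlaquetteBoson.pbParticleHole_proof @ df15c1b03440 (prover) · by planner
sources: Tasaki2020, LiebMattis1962
[support, provable now; contributed by planner …-a5da44b83f-0 (folded duplicate route
PairBosonDome)] EXACT PARTICLE–HOLE SYMMETRY of the hard-core gas = global spin flip F = Π_x σˣ_x (a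
real permutation-type unitary on the S^z basis): for every anisotropy Δ, F commutes with
xxzHamiltonian 1 (torusGraph 2 M) (-1) Δ (SˣSˣ, SʸSʸ, SᶻSᶻ are each flip-invariant), maps the
magnetisation-Mag sector onto the (−Mag) sector — hence normalised sector ground states to
normalised sector ground states and lowestEnergyInSector(Mag) = lowestEnergyInSector(−Mag) — and F
S⁻_tot F = S⁺_tot, so ⟨Fψ, S⁺_tot S⁻_tot Fψ⟩ = ⟨ψ, S⁻_tot S⁺_tot ψ⟩ = ⟨ψ, S⁺_tot S⁻_tot ψ⟩ −
2·Mag·‖ψ‖² ([S⁺_tot, S⁻_tot] = 2S^z_tot; cf. LiebMattisSectorPF.re_norm_lower_eq). Boson reading: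
BB† = B†B + Σ_p(1 − 2n_p), i.e. Λ(M² − N) = Λ(N) + M² − 2N. USE: extends every-filling condensation
from ρ ∈ (0,1/2] (PbInterpolation / PbXYAllFillings) to ρ ∈ [1/2,1), i.e. to dopings δ = ρ/2 ∈
[1/4,1/2) of the summit window, so the witness doping of PbAnchorOrder may be chosen anywhere in
(0,1/2). ~150–250 Lean lines (F as Matrix.of fun σ τ => if ∀ x, σ x ≠ τ x then 1 else 0, or
globalRotation 1 (π about the x-axis)). Sources: Tasaki2020 §2.2, -/
@[route_item "route-HubbardSuperconductivity-PlaquetteBoson"]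
def PbParticleHole : Prop :=
  ∀ Δ : ℝ, ∀ (M : ℕ) [NeZero M], ∀ (Mag : ℝ) (ψ : Literature.MathematicalPhysics.QuantumLattice.TensorIndex (Literature.Probability.LatticeModels.TorusSite 2 M) 2 → ℂ), ψ ∈ Literature.MathematicalPhysics.QuantumLattice.spinZSector (Λ := Literature.Probability.LatticeModels.TorusSite 2 M) 1 Mag → star ψ ⬝ᵥ ψ = 1 → Matrix.mulVec (Literature.MathematicalPhysics.QuantumLattice.xxzHamiltonian 1 (Literature.Probability.LatticeModels.torusGraph 2 M) (-1) Δ) ψ = ((Literature.MathematicalPhysics.QuantumLattice.lowestEnergyInSector 1 (Literature.MathematicalPhysics.QuantumLattice.xxzHamiltonian 1 (Literature.Probability.LatticeModels.torusGraph 2 M) (-1) Δ) Mag : ℝ) : ℂ) • ψ → ∃ ψ' : Literature.MathematicalPhysics.QuantumLattice.TensorIndex (Literature.Probability.LatticeModels.TorusSite 2 M) 2 → ℂ, ψ' ∈ Literature.MathematicalPhysics.QuantumLattice.spinZSector (Λ := Literature.Probability.LatticeModels.TorusSite 2 M) 1 (-Mag) ∧ star ψ' ⬝ᵥ ψ' =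 1 ∧ Matrix.mulVec (Literature.MathematicalPhysics.QuantumLattice.xxzHamiltonian 1 (Literature.Probability.LatticeModels.torusGraph 2 M) (-1) Δ) ψ' = ((Literature.MathematicalPhysics.QuantumLattice.lowestEnergyInSector 1 (Literature.MathematicalPhysics.QuantumLattice.xxzHamiltonian 1 (Literature.Probability.LatticeModels.torusGraph 2 M) (-1) Δ) (-Mag) : ℝ) : ℂ) • ψ' ∧ (star ψ' ⬝ᵥ Matrix.mulVec ((∑ x : Literature.Probability.LatticeModels.TorusSite 2 M, Literature.MathematicalPhysics.QuantumLattice.onSite x (Literature.MathematicalPhysics.QuantumLattice.spinRaise 1)) * (∑ y : Literature.Probability.LatticeModels.TorusSite 2 M, Literature.MathematicalPhysics.QuantumLattice.onSite y (Literature.MathematicalPhysics.QuantumLattice.spinLower 1))) ψ').re = (star ψ ⬝ᵥ Matrix.mulVec ((∑ x : Literature.Probability.LatticeModels.TorusSite 2 M, Literature.MathematicalPhysics.QuantumLattice.onSite x (Literature.MathematicalPhysics.QuantumLattice.spinRaise 1)) * (∑ y : Literature.Probability.LatticeModels.TorusSite 2 M, Literature.MathematicalPhysics.QuantumLattice.onSite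 y (Literature.MathematicalPhysics.QuantumLattice.spinLower 1))) ψ).re - 2 * Mag

-- `PbParticleHole` holds: proved by `Summit.HubbardSuperconductivity.HubbardSuperconductivity.Theorems.PlaquetteBoson.pbParticleHole_proof` @ df15c1b03440 (its module imports this route file, so no `_holds` link can be stated here).

/-- item stmt-HubbardSuperconductivity-0909 · assembly · rank 1 · closed · proved by Summit.HubbardSuperconductivity.HubbardSuperconductivity.Theorems.plaquetteBoson_assembly_proof @ 8dd64b825ac9 (prover) · by planner
sources: Scalapino1995
[assembly] Pure logic (planner sketch rc0: `intro hA hC; obtain ⟨U,hU,δ,hδ,h⟩ := hA; exact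
⟨U,hU,δ,hδ,fun N ψ hyp => hC U δ hU hδ h N ψ hyp⟩`). The bosonic items PbMonotoneDepletion /
PbHalfFilledXYOrder / PbInterpolation are the typed second layer under PbAnchorOrder; their glue
(Schrieffer–Wolff + dressing lemma) is filed at the first split. -/
@[route_item "route-HubbardSuperconductivity-PlaquetteBoson"]
def Assembly : Prop :=
  PbAnchorOrder → PbContinuation → HubbardSuperconductivity

-- `Assembly` holds: proved by `Summit.HubbardSuperconductivity.HubbardSuperconductivity.Theorems.plaquetteBoson_assembly_proof` @ 8dd64b825ac9 (its module imports this route file, so no `_holds` link can be stated here).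

-- records of items no longer active in this route (dropped / restated):
-- earlier PbXYSectorAnchor (stmt-HubbardSuperconductivity-0977, dropped 2026-08-17T11:41:48Z): proved by Summit.HubbardSuperconductivity.HubbardSuperconductivity.Theorems.AnisotropyChord.sectorAnchorXY_proof @ c0c71b94710e — ∃ c : ℝ, 0 < c ∧ ∃ M₀ : ℕ, ∀ (M : ℕ) [NeZero M], Even M → M₀ ≤ M → ∀ (ψ : Literature.MathematicalPhysics.QuantumLattice.TensorIndex (Literature.Probability.LatticeModels.TorusSi

/-! D-0027 §2.1 — DECIDING THEOREM (planner-authored via `route open/edit --closes-file`; by planner-rbadge-HubbardSuperconductivity-Plaque-954a431b-g2-0 2026-08-15T16:10:50Z):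
its hypotheses are this route's items and its conclusion the sub-problem Statement (glue_lint), and it elaborates with this file. -/

@[closes "route-HubbardSuperconductivity-PlaquetteBoson"] theorem closes (hA : PbAnchorOrder) (hC : PbContinuation) :
    _root_.HubbardSuperconductivity := by
  obtain ⟨U, hU, δ, hδ, h⟩ := hA
  exact ⟨U, hU, δ, hδ, fun N ψ hyp => hC U δ hU hδ h N ψ hyp⟩

end Summit.HubbardSuperconductivity.HubbardSuperconductivity.Theses.PlaquetteBoson
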